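import Literature.Combinatorics.Optimization.CorrelationPolytopeFaces
import Literature.Combinatorics.Optimization.GridCoordinates
import Literature.Computability.MetaComplexity.GridTseitinLift
import HarnessLib

/-!
# Tiling theorem for `GridCorCliqueFace`: abstract crossover / junction blocks of pitch `K` in the
# grid `G_{t,t}` give a face of `COR(G_{t,t})` projecting onto `COR(K_{⌊t/K⌋})`
# (the core of Aboulker–Fiorini–Huynh–Macchia–Seif 2019, Theorem 6, in place)

[topic Combinatorics/Optimization]

P. Aboulker, S. Fiorini, T. Huynh, M. Macchia, J. Seif, *Extension complexity of the correlation
polytope*, Oper. Res. Lett. 47 (2019) 47–51 = arXiv:1806.00541 [AboulkerEtAl2019] (held text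
`paper:arxiv-1806.00541`), proof of Theorem 6 (p0005 L49 – p0006 L27): inside the grid one builds
horizontal and vertical WIRES ("the value of the variable for each bottom and each left vertex of the
grid propagates along the corresponding vertical and horizontal path", p0005 L55), CROSSOVER gadgets
where they meet ("the gadgets make sure that propagation along vertical paths does not interfere with
propagation along horizontal paths", p0005 L56), all cut out as ONE FACE of the correlation polytope by
equations that "originate from valid inequalities" (p0006 L2–3), and projects onto the correlation
polytope of a complete (bipartite) graph by reading one coordinate per terminal and per crossing
("by projecting onto the diagonal dotted edges … the face … projects to `COR(K_{h,h})`", p0006 L19–20;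
"`K_h` is a minor of `K_{h,h}`", L21).

This file proves the TILING / PROPAGATION / PROJECTION part of that argument ONCE, for ABSTRACT
blocks, directly on `COR(G_{t,t})` (`corPolytopeGraph (gridGraph t)`, the tree's renderings of
`COR` and of the `t × t` grid), in the literal shape of the `ValiantsHypothesis` support item
`GridCorCliqueFace` (FORM A).  The data of a block of pitch `K` are: finitely many rows
`(rowsX t i j r, rhsX r)` attached to the copy of the block at block position `(i,j)` of `G_{t,t}`
(rows `K i … K i + K - 1`, columns `K j … K j + K - 1`, cell `(r,c) ↦ (K i + r)·t + (K j + c)`),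
Boolean truth tables `ttX cell A B` (the canonical satisfying assignment on inputs `A` = row signal,
`B` = column signal), four PORT cells `pl = (ρ,0)`, `pr = (ρ,K-1)`, `pt = (0,κ)`, `pb = (K-1,κ)` and an
adjacent READOUT pair `ra ~ rb`; and three finite properties — (V) every row is valid on every `0/1`
generator `corVec (gridGraph t) b`; (D) if all rows of the block are tight at `corVec _ b` then
`b pr = b pl`, `b pt = b pb`, `b ra = b pl`, `b rb = b pb` (the crossover RELATION, symmetric in the
vertical direction); (L) the canonical assignment `cell ↦ ttX cell A B` makes every row tight, and
`ttX` gives the ports the values `A, A, B, B`.  A JUNCTION block (used on the diagonal, where column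
`j` is fed from row `j`) has rows `rowsJ t i`, one signal, (D) all four ports equal, (L) likewise.

* `face_image_eq_of_blocks` — for every `t > 0`, with `h = ⌊t/K⌋`: tile the `h × h` blocks (crossover
  off the diagonal, junction on it), join horizontally / vertically neighbouring ports by WIRE rows
  (`x_u = x_{uv} = x_v`, `CorrelationPolytopeFaces.lean`), let `π` read the terminal `τ_i` = left port
  of block `(i,0)` at `(i,i)` and the readout pair of block `(i,j)` at `(i,j)`, `i ≠ j`; then every row
  is valid on `COR(G_{t,t})` and `π '' (COR(G_{t,t}) ∩ {all rows tight}) = COR(K_h)`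
  (`corPolytopeGraph ⊤` on `Fin h`).  Proof: validity row by row; DESCEND — tightness gives the port
  relations block by block and equality across the joins, whence (`propagate`) row `i` carries
  `u_i := b τ_i` and column `j` carries `u_j` (from the junction `(j,j)` downwards AND upwards), so the
  readout coordinate of block `(i,j)` is `u_i u_j` and `π (corVec _ b) = corVec ⊤ u`; LIFT — for
  `u : Fin h → Bool` the assignment "cell of block `(i,j)` ↦ `ttX cell u_i u_j` (`ttJ cell u_i` on the
  diagonal), everything else `false`" is tight on every row (block rows by (L), joins because both
  ends carry `u_i`, resp. `u_j`), and by DESCEND it maps to `corVec ⊤ u`; the assembly lemma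
  `exists_finValidFace_image_eq` (`CorrelationPolytopeFaces.lean`) turns (validity, descend, lift)
  into the image EQUALITY and the `Fin k` indexing;
* `formA_of_blocks` — the same packaged as FORM A: `∃ c > 0, ∃ t₀, ∀ t ≥ t₀, ∃ h ≥ c·t, ∃ k cv δ π, …`
  with `c = 1/(2K)`, `t₀ = 2K` (`pitch_bound`: `t/(2K) ≤ ⌊t/K⌋` for `t ≥ 2K`);
* `gridGraph_adj_iff`, `block_adj`, `join_adj_right`, `join_adj_down`, `exists_blockMap` — row-major
  grid arithmetic for blocks (value-level block maps `ι : Fin K × Fin K → Fin (t·t)`,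
  `(ι p : ℕ) = (K i + p.1)·t + (K j + p.2)`; cf. `GridCoordinates.lean` for the coordinate API of the
  gate modules): local grid-adjacency inside a block transports to `G_{t,t}`, which is how a block
  lemma proved over an ARBITRARY graph with an embedded `K × K` pattern discharges (V)/(D)/(L) here.

No definition, no named fact; the blocks themselves (the gate / crossover modules, a DIFFERENT gadget
from the printed Lichtenstein-based one but the same principle "valid inequalities at equality
simulate Boolean constraints") are supplied by the construction modules and are NOT in this file; the
consequence for extension complexity (`xc(COR(G_{t,t})) ≥ 2^{Ω(t)}`, Kaibel–Weltge) is drawn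
elsewhere (`CorrelationPolytopeXCLowerBoundGraph.lean`, `CorrelationPolytopeMinorMonotone.lean`).

## References

* [AboulkerEtAl2019] P. Aboulker, S. Fiorini, T. Huynh, M. Macchia, J. Seif, *Extension complexity
  of the correlation polytope*, Oper. Res. Lett. 47 (2019) 47–51 = arXiv:1806.00541; §2: the grid
  `G_{h,h}` (p0005 L21), Obs. 5 and its proof (p0005 L12–18: contraction face `x_u = x_{uv} = x_v`),
  Thm. 6 and its proof (p0005 L41 – p0006 L27: wires, crossover gadgets, "equations … originate from
  valid inequalities", projection onto `COR(K_{h,h})`, `K_h ≼ K_{h,h}`).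
* [HastadRisse2025] for the tree's `gridGraph` (`GridTseitinLift.lean`).
* [FioriniEtAl2015] S. Fiorini, S. Massar, S. Pokutta, H. R. Tiwary, R. de Wolf, *Exponential lower
  bounds for polytopes in combinatorial optimization*, J. ACM 62 (2015), Lemma 9 (faces, projections).
-/

noncomputable section

namespace Literature.Combinatorics.Optimization

open Finset
open Literature.Barriers.PneNP (HasEFOfSize)
open Literature.Computability.MetaComplexity (gridGraph gridAdj)

namespace GridCorTiling

/-! ### Row-major arithmetic on `Fin (t·t)` -/

/-! ### Blocks of pitch `K` -/

variable {K : ℕ}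

/-- **Blocks transport adjacency.**  For the value-level block map `ι` of block `(i,j)`
(`(ι p : ℕ) = (K i + p.1)·t + (K j + p.2)`), cells adjacent in the `K × K` pattern are adjacent in
`G_{t,t}` — so a gadget lemma proved over an arbitrary graph containing the pattern applies to every
block of the grid. [cite: AboulkerEtAl2019, §2 (p0005 L21) and proof of Thm. 6 (p0005 L51–60: gadgets placed in the grid)] -/
theorem block_adj {t : ℕ} (i j : ℕ) (hj : K * j + K ≤ t)
    (ι : Fin K × Fin K → Fin (t * t))
    (hι : ∀ p, (ι p : ℕ) = (K * i + p.1) * t + (K * j + p.2))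
    {p q : Fin K × Fin K}
    (hpq : (p.1 = q.1 ∧ ((p.2 : ℕ) + 1 = q.2 ∨ (q.2 : ℕ) + 1 = p.2)) ∨
      (p.2 = q.2 ∧ ((p.1 : ℕ) + 1 = q.1 ∨ (q.1 : ℕ) + 1 = p.1))) :
    (gridGraph t).Adj (ι p) (ι q) := by
  have hp2 : K * j + p.2 < t := by have := p.2.isLt; omega
  have hq2 : K * j + q.2 < t := by have := q.2.isLt; omega
  rw [gridAdj_block_iff (hι p) (hι q) hp2 hq2]
  rcases hpq with ⟨h1, h2⟩ | ⟨h1, h2⟩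
  · exact Or.inl ⟨by rw [h1], h2⟩
  · exact Or.inr ⟨by rw [h1], h2⟩

/-- Horizontal joining edge between blocks `(i,j)` and `(i,j+1)`: the right port `(ρ, K-1)` of the
first is grid-adjacent to the left port `(ρ, 0)` of the second. [cite: AboulkerEtAl2019, proof of Thm. 6 (p0006 L17–19: propagation along horizontal paths)] -/
theorem join_adj_right {t : ℕ} (i j : ℕ) (hj : K * (j + 1) + K ≤ t)
    (ι ι' : Fin K × Fin K → Fin (t * t))
    (hι : ∀ p, (ι p : ℕ) = (K * i + p.1) * t + (K * j + p.2))
    (hι' : ∀ p, (ι' p : ℕ) = (K * i + p.1) * t + (K * (j + 1) + p.2))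
    (p q : Fin K × Fin K) (hpq : p.1 = q.1) (hp : (p.2 : ℕ) = K - 1) (hq : (q.2 : ℕ) = 0) :
    (gridGraph t).Adj (ι p) (ι' q) := by
  have hj' : K * j + K + K ≤ t := by rw [Nat.mul_succ] at hj; exact hj
  have hp2 : K * j + p.2 < t := by have := p.2.isLt; omega
  have hq2 : K * (j + 1) + q.2 < t := by have := q.2.isLt; rw [Nat.mul_succ]; omega
  rw [gridAdj_iff_of_val_eq (hι p) (hι' q) hp2 hq2]
  left
  refine ⟨by rw [hpq], Or.inl ?_⟩
  have := p.2.isLt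
  rw [hp, hq, Nat.mul_succ]
  omega

/-- Vertical joining edge between blocks `(i,j)` and `(i+1,j)`: the bottom port `(K-1, κ)` of the
first is grid-adjacent to the top port `(0, κ)` of the second. [cite: AboulkerEtAl2019, proof of Thm. 6 (p0006 L17–19: propagation along vertical paths)] -/
theorem join_adj_down {t : ℕ} (i j : ℕ) (hj : K * j + K ≤ t)
    (ι ι' : Fin K × Fin K → Fin (t * t))
    (hι : ∀ p, (ι p : ℕ) = (K * i + p.1) * t + (K * j + p.2))
    (hι' : ∀ p, (ι' p : ℕ) = (K * (i + 1) + p.1) * t + (K * j + p.2))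
    (p q : Fin K × Fin K) (hpq : p.2 = q.2) (hp : (p.1 : ℕ) = K - 1) (hq : (q.1 : ℕ) = 0) :
    (gridGraph t).Adj (ι p) (ι' q) := by
  have hp2 : K * j + p.2 < t := by have := p.2.isLt; omega
  have hq2 : K * j + q.2 < t := by have := q.2.isLt; omega
  rw [gridAdj_iff_of_val_eq (hι p) (hι' q) hp2 hq2]
  right
  refine ⟨by rw [hpq], Or.inl ?_⟩
  have := p.1.isLt
  rw [hp, hq, Nat.mul_succ]
  omega

/-- The block maps exist (value-level specification `(ι i j p : ℕ) = (K i + p.1)·t + (K j + p.2)` for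
all blocks inside the grid). [cite: AboulkerEtAl2019, §2 (p0005 L21)] [folklore] -/
theorem exists_blockMap (t K : ℕ) (ht : 0 < t) :
    ∃ ι : ℕ → ℕ → Fin K × Fin K → Fin (t * t),
      ∀ i j, K * i + K ≤ t → K * j + K ≤ t →
        ∀ p, (ι i j p : ℕ) = (K * i + p.1) * t + (K * j + p.2) := by
  refine ⟨fun i j p => ⟨((K * i + p.1) % t) * t + (K * j + p.2) % t,
    (vtx_spec (Nat.mod_lt _ ht) (Nat.mod_lt _ ht)).1⟩, fun i j hi hj p => ?_⟩
  have h1 : K * i + p.1 < t := by have := p.1.isLt; omega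
  have h2 : K * j + p.2 < t := by have := p.2.isLt; omega
  simp only [Nat.mod_eq_of_lt h1, Nat.mod_eq_of_lt h2]


/-! ### Propagation of port values through the tiling -/

/-- PROPAGATION, pure bookkeeping: left/right/top/bottom port values of the blocks `(i,j)`, `i,j < h`, with
«right = left» and «top = bottom» inside every block, «top = left» in the diagonal (junction) blocks,
and equality across the joining edges, are all determined by the left ports of the blocks `(i,0)`:
row `i` carries `L i 0`, column `j` carries `L j 0`.
[cite: AboulkerEtAl2019, proof of Thm. 6 (arXiv:1806.00541 p0005 L55–56, p0006 L17–19: "the value … propagates")] -/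
theorem propagate {h : ℕ} (L R U D : ℕ → ℕ → Bool)
    (hLR : ∀ i j, i < h → j < h → R i j = L i j)
    (hUD : ∀ i j, i < h → j < h → U i j = D i j)
    (hJ : ∀ i, i < h → U i i = L i i)
    (hH : ∀ i j, i < h → j + 1 < h → R i j = L i (j + 1))
    (hV : ∀ i j, i + 1 < h → j < h → D i j = U (i + 1) j) :
    (∀ i j, i < h → j < h → L i j = L i 0) ∧
      (∀ i j, i < h → j < h → U i j = L j 0 ∧ D i j = L j 0) := by
  have hrow : ∀ i j, i < h → j < h → L i j = L i 0 := by
    intro i j hi hj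
    induction j with
    | zero => rfl
    | succ n ih =>
      have hn : n < h := by omega
      rw [← hH i n hi hj, hLR i n hi hn, ih hn]
  refine ⟨hrow, ?_⟩
  -- columns: from the diagonal block downwards and upwards
  have hdiag : ∀ j, j < h → U j j = L j 0 ∧ D j j = L j 0 := by
    intro j hj
    have h1 : U j j = L j 0 := by rw [hJ j hj, hrow j j hj hj]
    exact ⟨h1, by rw [← hUD j j hj hj, h1]⟩
  have hdown : ∀ d j, j + d < h → U (j + d) j = L j 0 ∧ D (j + d) j = L j 0 := by
    intro d
    induction d with
    | zero => intro j hj; simpa using hdiag j (by simpa using hj)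
    | succ d ih =>
      intro j hj
      have hprev := ih j (by omega)
      have hU : U (j + (d + 1)) j = L j 0 := by
        rw [show j + (d + 1) = j + d + 1 by omega, ← hV (j + d) j (by omega) (by omega)]
        exact hprev.2
      exact ⟨hU, by rw [← hUD _ _ hj (by omega), hU]⟩
  have hup : ∀ d i, i + d < h → U i (i + d) = L (i + d) 0 ∧ D i (i + d) = L (i + d) 0 := by
    intro d
    induction d with
    | zero => intro i hi; simpa using hdiag i (by simpa using hi)
    | succ d ih =>
      intro i hi
      have hprev := ih (i + 1) (by omega)
      rw [show i + 1 + d = i + (d + 1) by omega] at hprev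
      have hD : D i (i + (d + 1)) = L (i + (d + 1)) 0 := by
        rw [hV i _ (by omega) (by omega)]
        exact hprev.1
      exact ⟨by rw [hUD _ _ (by omega) (by omega), hD], hD⟩
  intro i j hi hj
  rcases Nat.le_total j i with hle | hle
  · obtain ⟨d, rfl⟩ := Nat.exists_eq_add_of_le hle
    exact hdown d j hi
  · obtain ⟨d, rfl⟩ := Nat.exists_eq_add_of_le hle
    exact hup d i hj

/-! ### Decoding block cells -/

/-- Row and column of a block cell. [folklore] [cite: AboulkerEtAl2019, §2 (p0005 L21)] -/
theorem block_decode {t K i j : ℕ} (ι : Fin K × Fin K → Fin (t * t))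
    (hι : ∀ p, (ι p : ℕ) = (K * i + p.1) * t + (K * j + p.2)) (hi : K * i + K ≤ t)
    (hj : K * j + K ≤ t) (p : Fin K × Fin K) :
    (ι p : ℕ) / t = K * i + p.1 ∧ (ι p : ℕ) % t = K * j + p.2 := by
  have hp1 : K * i + p.1 < t := by have := p.1.isLt; omega
  have hp2 : K * j + p.2 < t := by have := p.2.isLt; omega
  rw [hι p]
  exact (vtx_spec hp1 hp2).2

/-- Block index and offset of a coordinate `K i + r`, `r < K`. [folklore] [cite: AboulkerEtAl2019, §2 (p0005 L21)] -/
theorem quot_decode {K i r : ℕ} (hK : 0 < K) (hr : r < K) :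
    (K * i + r) / K = i ∧ (K * i + r) % K = r := by
  constructor
  · rw [Nat.add_comm, Nat.add_mul_div_left _ _ hK, Nat.div_eq_of_lt hr, Nat.zero_add]
  · rw [Nat.add_comm, Nat.add_mul_mod_self_left, Nat.mod_eq_of_lt hr]

/-! ### The tiling theorem -/

/-- **Tiling theorem: abstract crossover / junction blocks of pitch `K` give a face of `COR(G_{t,t})`,
cut out by inequalities valid on all of `COR(G_{t,t})`, whose image under a linear map IS
`COR(K_{⌊t/K⌋})`.**  Hypotheses (see the module doc): port geometry `pl = (ρ,0)`, `pr = (ρ,K-1)`,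
`pt = (0,κ)`, `pb = (K-1,κ)`, an adjacent readout pair `ra ~ rb`; truth tables giving the ports the
values `A, A, B, B` (crossover) / `A` (junction); and for every copy of a block inside `G_{t,t}`
(value-level block map `ι`): (V) validity of each row on every generator, (D) tight rows force
`b pr = b pl ∧ b pt = b pb ∧ b ra = b pl ∧ b rb = b pb` (crossover) / all ports equal (junction),
(L) the canonical assignment is tight.  Conclusion = the inner block of FORM A at this `t` with
`h = t / K`.  The wires, the crossover principle and the projection are the printed ones; the
gadgets are abstract here. [cite: AboulkerEtAl2019, proof of Thm. 6 (arXiv:1806.00541 p0005 L49 – p0006 L21)] -/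
theorem face_image_eq_of_blocks {K : ℕ} (hK : 0 < K) {nX nJ : ℕ}
    (rowsX : ∀ t : ℕ, ℕ → ℕ → Fin nX → (Fin (t * t) × Fin (t * t) → ℝ)) (rhsX : Fin nX → ℝ)
    (rowsJ : ∀ t : ℕ, ℕ → Fin nJ → (Fin (t * t) × Fin (t * t) → ℝ)) (rhsJ : Fin nJ → ℝ)
    (ttX : Fin K × Fin K → Bool → Bool → Bool) (ttJ : Fin K × Fin K → Bool → Bool)
    (pl pr pt pb ra rb : Fin K × Fin K)
    (hplr : pl.1 = pr.1) (hpl : (pl.2 : ℕ) = 0) (hpr : (pr.2 : ℕ) = K - 1)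
    (hptb : pt.2 = pb.2) (hpt : (pt.1 : ℕ) = 0) (hpb : (pb.1 : ℕ) = K - 1)
    (hrab : (ra.1 = rb.1 ∧ ((ra.2 : ℕ) + 1 = rb.2 ∨ (rb.2 : ℕ) + 1 = ra.2)) ∨
      (ra.2 = rb.2 ∧ ((ra.1 : ℕ) + 1 = rb.1 ∨ (rb.1 : ℕ) + 1 = ra.1)))
    (httX : ∀ A B, ttX pl A B = A ∧ ttX pr A B = A ∧ ttX pt A B = B ∧ ttX pb A B = B)
    (httJ : ∀ A, ttJ pl A = A ∧ ttJ pr A = A ∧ ttJ pt A = A ∧ ttJ pb A = A)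
    (hXvalid : ∀ t i j, K * i + K ≤ t → K * j + K ≤ t →
      ∀ r b, rowsX t i j r ⬝ᵥ corVec (gridGraph t) b ≤ rhsX r)
    (hXdesc : ∀ (t i j : ℕ) (ι : Fin K × Fin K → Fin (t * t)),
      (∀ p, (ι p : ℕ) = (K * i + p.1) * t + (K * j + p.2)) → K * i + K ≤ t → K * j + K ≤ t →
      ∀ b : Fin (t * t) → Bool, (∀ r, rowsX t i j r ⬝ᵥ corVec (gridGraph t) b = rhsX r) →
        b (ι pr) = b (ι pl) ∧ b (ι pt) = b (ι pb) ∧ b (ι ra) = b (ι pl) ∧ b (ι rb) = b (ι pb))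
    (hXlift : ∀ (t i j : ℕ) (ι : Fin K × Fin K → Fin (t * t)),
      (∀ p, (ι p : ℕ) = (K * i + p.1) * t + (K * j + p.2)) → K * i + K ≤ t → K * j + K ≤ t →
      ∀ (A B : Bool) (b : Fin (t * t) → Bool), (∀ p, b (ι p) = ttX p A B) →
        ∀ r, rowsX t i j r ⬝ᵥ corVec (gridGraph t) b = rhsX r)
    (hJvalid : ∀ t i, K * i + K ≤ t → ∀ r b, rowsJ t i r ⬝ᵥ corVec (gridGraph t) b ≤ rhsJ r)
    (hJdesc : ∀ (t i : ℕ) (ι : Fin K × Fin K → Fin (t * t)),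
      (∀ p, (ι p : ℕ) = (K * i + p.1) * t + (K * i + p.2)) → K * i + K ≤ t →
      ∀ b : Fin (t * t) → Bool, (∀ r, rowsJ t i r ⬝ᵥ corVec (gridGraph t) b = rhsJ r) →
        b (ι pr) = b (ι pl) ∧ b (ι pt) = b (ι pl) ∧ b (ι pb) = b (ι pl))
    (hJlift : ∀ (t i : ℕ) (ι : Fin K × Fin K → Fin (t * t)),
      (∀ p, (ι p : ℕ) = (K * i + p.1) * t + (K * i + p.2)) → K * i + K ≤ t →
      ∀ (A : Bool) (b : Fin (t * t) → Bool), (∀ p, b (ι p) = ttJ p A) →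
        ∀ r, rowsJ t i r ⬝ᵥ corVec (gridGraph t) b = rhsJ r)
    (t : ℕ) (ht : 0 < t) :
    ∃ (k : ℕ) (cv : Fin k → (Fin (t * t) × Fin (t * t) → ℝ)) (δ : Fin k → ℝ)
      (π : (Fin (t * t) × Fin (t * t) → ℝ) →ₗ[ℝ] (Fin (t / K) × Fin (t / K) → ℝ)),
      (∀ i, ∀ x ∈ corPolytopeGraph (gridGraph t), cv i ⬝ᵥ x ≤ δ i) ∧
        π '' (corPolytopeGraph (gridGraph t) ∩ {x | ∀ i, cv i ⬝ᵥ x = δ i}) =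
          corPolytopeGraph (⊤ : SimpleGraph (Fin (t / K))) := by
  classical
  -- `h = t / K` blocks per row / column
  generalize hh : t / K = h
  have hKh : K * h ≤ t := by rw [← hh, Nat.mul_comm]; exact Nat.div_mul_le_self t K
  have hblk : ∀ i : ℕ, i < h → K * i + K ≤ t := fun i hi =>
    le_trans (by rw [← Nat.mul_succ]; exact Nat.mul_le_mul_left K hi) hKh
  -- the block maps (value-level specification)
  obtain ⟨ι, hι⟩ := exists_blockMap t K ht
  -- adjacency of the joining edges and of the readout pairs
  have hadjH : ∀ i j : ℕ, i < h → j + 1 < h →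
      (gridGraph t).Adj (ι i j pr) (ι i (j + 1) pl) :=
    fun i j hi hj => join_adj_right i j (hblk _ hj) (ι i j) (ι i (j + 1))
      (hι i j (hblk i hi) (hblk j (by omega))) (hι i (j + 1) (hblk i hi) (hblk _ hj))
      pr pl hplr.symm hpr hpl
  have hadjV : ∀ i j : ℕ, i + 1 < h → j < h →
      (gridGraph t).Adj (ι i j pb) (ι (i + 1) j pt) :=
    fun i j hi hj => join_adj_down i j (hblk j hj) (ι i j) (ι (i + 1) j)
      (hι i j (hblk i (by omega)) (hblk j hj)) (hι (i + 1) j (hblk _ hi) (hblk j hj))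
      pb pt hptb.symm hpb hpt
  have hadjR : ∀ i j : ℕ, i < h → j < h → (gridGraph t).Adj (ι i j ra) (ι i j rb) :=
    fun i j hi hj => block_adj i j (hblk j hj) (ι i j) (hι i j (hblk i hi) (hblk j hj)) hrab
  -- wire rows (both orientations of one grid edge)
  let wrow : Fin (t * t) → Fin (t * t) → Bool → (Fin (t * t) × Fin (t * t) → ℝ) :=
    fun u v s => if s then Pi.single (u, v) 1 - Pi.single (u, u) 1
      else Pi.single (v, u) 1 - Pi.single (v, v) 1
  have wrow_valid : ∀ u v, (gridGraph t).Adj u v → ∀ (s : Bool) (b : Fin (t * t) → Bool),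
      wrow u v s ⬝ᵥ corVec (gridGraph t) b ≤ 0 := by
    intro u v huv s b
    cases s
    · exact wire_dotProduct_corVec_le b huv.symm
    · exact wire_dotProduct_corVec_le b huv
  have wrow_tight_iff : ∀ u v, (gridGraph t).Adj u v → ∀ b : Fin (t * t) → Bool,
      (∀ s, wrow u v s ⬝ᵥ corVec (gridGraph t) b = 0) ↔ b u = b v := by
    intro u v huv b
    constructor
    · intro hs
      exact Bool.eq_iff_iff.2 ⟨(wire_dotProduct_corVec_eq_zero_iff b huv).1 (hs true),
        (wire_dotProduct_corVec_eq_zero_iff b huv.symm).1 (hs false)⟩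
    · intro huv' s
      cases s
      · exact (wire_dotProduct_corVec_eq_zero_iff b huv.symm).2 fun h' => huv'.trans h'
      · exact (wire_dotProduct_corVec_eq_zero_iff b huv).2 fun h' => huv'.symm.trans h'
  -- the rows: crossover blocks, junction blocks, horizontal joins, vertical joins
  let cv : (({q : Fin h × Fin h // q.1 ≠ q.2} × Fin nX) ⊕ (Fin h × Fin nJ)) ⊕
      (({q : Fin h × Fin h // (q.2 : ℕ) + 1 < h} × Bool) ⊕
        ({q : Fin h × Fin h // (q.1 : ℕ) + 1 < h} × Bool)) →
      (Fin (t * t) × Fin (t * t) → ℝ) :=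
    Sum.elim
      (Sum.elim (fun q => rowsX t q.1.1.1 q.1.1.2 q.2) (fun q => rowsJ t q.1 q.2))
      (Sum.elim
        (fun q => wrow (ι q.1.1.1 q.1.1.2 pr) (ι q.1.1.1 ((q.1.1.2 : ℕ) + 1) pl) q.2)
        (fun q => wrow (ι q.1.1.1 q.1.1.2 pb) (ι ((q.1.1.1 : ℕ) + 1) q.1.1.2 pt) q.2))
  let δ : (({q : Fin h × Fin h // q.1 ≠ q.2} × Fin nX) ⊕ (Fin h × Fin nJ)) ⊕
      (({q : Fin h × Fin h // (q.2 : ℕ) + 1 < h} × Bool) ⊕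
        ({q : Fin h × Fin h // (q.1 : ℕ) + 1 < h} × Bool)) → ℝ :=
    Sum.elim (Sum.elim (fun q => rhsX q.2) (fun q => rhsJ q.2)) (fun _ => 0)
  -- the projection: terminals `τ i` (left port of block `(i,0)`) and readout pairs
  let τ : Fin h → Fin (t * t) := fun i => ι i 0 pl
  let coord : Fin h × Fin h → Fin (t * t) × Fin (t * t) := fun q =>
    if q.1 = q.2 then (τ q.1, τ q.1) else (ι q.1 q.2 ra, ι q.1 q.2 rb)
  let π : (Fin (t * t) × Fin (t * t) → ℝ) →ₗ[ℝ] (Fin h × Fin h → ℝ) :=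
    LinearMap.funLeft ℝ ℝ coord
  have hπ : ∀ x q, π x q = x (coord q) := fun x q => rfl
  -- validity of every row on the generators
  have hvalid : ∀ idx b, cv idx ⬝ᵥ corVec (gridGraph t) b ≤ δ idx := by
    rintro ((⟨⟨⟨i, j⟩, hij⟩, r⟩ | ⟨i, r⟩) | (⟨⟨⟨i, j⟩, hj⟩, s⟩ | ⟨⟨⟨i, j⟩, hi⟩, s⟩)) b
    · exact hXvalid t i j (hblk i i.isLt) (hblk j j.isLt) r b
    · exact hJvalid t i (hblk i i.isLt) r b
    · exact wrow_valid _ _ (hadjH i j i.isLt hj) s b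
    · exact wrow_valid _ _ (hadjV i j hi j.isLt) s b
  -- DESCEND: tightness forces the port values, and `π` reads `corVec ⊤ (b ∘ τ)`
  have desc : ∀ b : Fin (t * t) → Bool, (∀ idx, cv idx ⬝ᵥ corVec (gridGraph t) b = δ idx) →
      π (corVec (gridGraph t) b) = corVec ⊤ (fun i => b (τ i)) := by
    intro b hb
    have hX : ∀ (i j : ℕ) (hi : i < h) (hj : j < h), i ≠ j →
        b (ι i j pr) = b (ι i j pl) ∧ b (ι i j pt) = b (ι i j pb) ∧
          b (ι i j ra) = b (ι i j pl) ∧ b (ι i j rb) = b (ι i j pb) := by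
      intro i j hi hj hij
      refine hXdesc t i j (ι i j) (hι i j (hblk i hi) (hblk j hj)) (hblk i hi) (hblk j hj) b ?_
      intro r
      have hne : (⟨i, hi⟩ : Fin h) ≠ ⟨j, hj⟩ := fun heq => hij (Fin.mk.inj_iff.1 heq)
      exact hb (Sum.inl (Sum.inl (⟨⟨(⟨i, hi⟩, ⟨j, hj⟩), hne⟩, r⟩)))
    have hJ : ∀ (i : ℕ) (hi : i < h),
        b (ι i i pr) = b (ι i i pl) ∧ b (ι i i pt) = b (ι i i pl) ∧ b (ι i i pb) = b (ι i i pl) := by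
      intro i hi
      refine hJdesc t i (ι i i) (hι i i (hblk i hi) (hblk i hi)) (hblk i hi) b fun r => ?_
      exact hb (Sum.inl (Sum.inr (⟨i, hi⟩, r)))
    have hH : ∀ (i j : ℕ), i < h → j + 1 < h → b (ι i j pr) = b (ι i (j + 1) pl) := by
      intro i j hi hj
      refine (wrow_tight_iff _ _ (hadjH i j hi hj) b).1 fun s => ?_
      exact hb (Sum.inr (Sum.inl (⟨⟨(⟨i, hi⟩, ⟨j, by omega⟩), hj⟩, s⟩)))
    have hV : ∀ (i j : ℕ), i + 1 < h → j < h → b (ι i j pb) = b (ι (i + 1) j pt) := by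
      intro i j hi hj
      refine (wrow_tight_iff _ _ (hadjV i j hi hj) b).1 fun s => ?_
      exact hb (Sum.inr (Sum.inr (⟨⟨(⟨i, by omega⟩, ⟨j, hj⟩), hi⟩, s⟩)))
    have hLR : ∀ i j : ℕ, i < h → j < h → b (ι i j pr) = b (ι i j pl) := by
      intro i j hi hj
      by_cases hij : i = j
      · subst hij; exact (hJ i hi).1
      · exact (hX i j hi hj hij).1
    have hUD : ∀ i j : ℕ, i < h → j < h → b (ι i j pt) = b (ι i j pb) := by
      intro i j hi hj
      by_cases hij : i = j
      · subst hij; exact (hJ i hi).2.1.trans (hJ i hi).2.2.symm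
      · exact (hX i j hi hj hij).2.1
    obtain ⟨hrow, hcol⟩ := propagate (h := h) (fun i j => b (ι i j pl)) (fun i j => b (ι i j pr))
      (fun i j => b (ι i j pt)) (fun i j => b (ι i j pb)) hLR hUD (fun i hi => (hJ i hi).2.1) hH hV
    funext q
    obtain ⟨i, j⟩ := q
    rw [hπ]
    by_cases hij : i = j
    · subst hij
      have hc : coord (i, i) = (τ i, τ i) := if_pos rfl
      rw [hc, corVec_apply_diag, corVec_apply_diag]
    · have hne : (i : ℕ) ≠ j := fun heq => hij (Fin.ext heq)
      have hc : coord (i, j) = (ι i j ra, ι i j rb) := if_neg hij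
      rw [hc, corVec_apply_adj (gridGraph t) b (hadjR i j i.isLt j.isLt),
        corVec_apply_adj ⊤ _ ((SimpleGraph.top_adj i j).2 hij)]
      have h1 : b (ι i j ra) = b (τ i) :=
        ((hX i j i.isLt j.isLt hne).2.2.1).trans (hrow i j i.isLt j.isLt)
      have h2 : b (ι i j rb) = b (τ j) :=
        ((hX i j i.isLt j.isLt hne).2.2.2).trans (hcol i j i.isLt j.isLt).2
      rw [h1, h2]
  -- LIFT: the canonical assignment attached to `b' : Fin h → Bool`
  have lift : ∀ b' : Fin h → Bool, ∃ b : Fin (t * t) → Bool,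
      (∀ idx, cv idx ⬝ᵥ corVec (gridGraph t) b = δ idx) ∧ π (corVec (gridGraph t) b) = corVec ⊤ b' := by
    intro b'
    let u : ℕ → Bool := fun n => if hn : n < h then b' ⟨n, hn⟩ else false
    let tX : ℕ → ℕ → Bool → Bool → Bool := fun r c A B =>
      if hr : r < K then (if hc : c < K then ttX (⟨r, hr⟩, ⟨c, hc⟩) A B else false) else false
    let tJ : ℕ → ℕ → Bool → Bool := fun r c A =>
      if hr : r < K then (if hc : c < K then ttJ (⟨r, hr⟩, ⟨c, hc⟩) A else false) else false
    let val : ℕ → ℕ → Bool := fun R C =>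
      if R / K < h ∧ C / K < h then
        (if R / K = C / K then tJ (R % K) (C % K) (u (R / K))
          else tX (R % K) (C % K) (u (R / K)) (u (C / K)))
      else false
    let b : Fin (t * t) → Bool := fun a => val ((a : ℕ) / t) ((a : ℕ) % t)
    have hu : ∀ i : Fin h, u i = b' i := fun i => by simp [u, i.isLt]
    have htX : ∀ (p : Fin K × Fin K) A B, tX p.1 p.2 A B = ttX p A B := fun p A B => by
      simp [tX, p.1.isLt, p.2.isLt]
    have htJ : ∀ (p : Fin K × Fin K) A, tJ p.1 p.2 A = ttJ p A := fun p A => by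
      simp [tJ, p.1.isLt, p.2.isLt]
    have hbval : ∀ (i j : ℕ), i < h → j < h → ∀ p : Fin K × Fin K,
        b (ι i j p) = if i = j then ttJ p (u i) else ttX p (u i) (u j) := by
      intro i j hi hj p
      obtain ⟨hd, hm⟩ := block_decode (ι i j) (hι i j (hblk i hi) (hblk j hj)) (hblk i hi) (hblk j hj) p
      obtain ⟨hq1, hr1⟩ := quot_decode (i := i) hK p.1.isLt
      obtain ⟨hq2, hr2⟩ := quot_decode (i := j) hK p.2.isLt
      simp only [b, val, hd, hm, hq1, hr1, hq2, hr2, hi, hj, and_self, if_true, htX, htJ]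
    have hport : ∀ (i j : ℕ), i < h → j < h →
        b (ι i j pl) = u i ∧ b (ι i j pr) = u i ∧ b (ι i j pt) = u j ∧ b (ι i j pb) = u j := by
      intro i j hi hj
      by_cases hij : i = j
      · subst hij
        simp only [hbval i i hi hi]
        exact ⟨(httJ _).1, (httJ _).2.1, (httJ _).2.2.1, (httJ _).2.2.2⟩
      · simp only [hbval i j hi hj, if_neg hij]
        exact ⟨(httX _ _).1, (httX _ _).2.1, (httX _ _).2.2.1, (httX _ _).2.2.2⟩
    have htight : ∀ idx, cv idx ⬝ᵥ corVec (gridGraph t) b = δ idx := by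
      rintro ((⟨⟨⟨i, j⟩, hij⟩, r⟩ | ⟨i, r⟩) | (⟨⟨⟨i, j⟩, hj⟩, s⟩ | ⟨⟨⟨i, j⟩, hi⟩, s⟩))
      · have hne : (i : ℕ) ≠ j := fun heq => hij (Fin.ext heq)
        exact hXlift t i j (ι i j) (hι i j (hblk i i.isLt) (hblk j j.isLt)) (hblk i i.isLt)
          (hblk j j.isLt) (u i) (u j) b (fun p => by rw [hbval i j i.isLt j.isLt p, if_neg hne]) r
      · exact hJlift t i (ι i i) (hι i i (hblk i i.isLt) (hblk i i.isLt)) (hblk i i.isLt) (u i) b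
          (fun p => by rw [hbval i i i.isLt i.isLt p, if_pos rfl]) r
      · refine (wrow_tight_iff _ _ (hadjH i j i.isLt hj) b).2 ?_ s
        rw [(hport i j i.isLt j.isLt).2.1, (hport i (j + 1) i.isLt hj).1]
      · refine (wrow_tight_iff _ _ (hadjV i j hi j.isLt) b).2 ?_ s
        rw [(hport i j i.isLt j.isLt).2.2.2, (hport (i + 1) j hi j.isLt).2.2.1]
    refine ⟨b, htight, ?_⟩
    rw [desc b htight]
    congr 1
    funext i
    exact ((hport i 0 i.isLt i.pos).1).trans (hu i)
  -- assemble (the `Fin k` re-indexing is `exists_finValidFace_image_eq`)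
  exact exists_finValidFace_image_eq (gridGraph t) ⊤ π cv δ hvalid
    (fun b hb => ⟨_, desc b hb⟩) lift

/-- **`c · t ≤ ⌊t/K⌋` for `c = 1/(2K)` and `t ≥ 2K`** (the pitch arithmetic of the tiling).
[cite: AboulkerEtAl2019, proof of Thm. 6 (arXiv:1806.00541 p0005 L51: "there exists h = Ω(t)")] [folklore] -/
theorem pitch_bound {K t : ℕ} (hK : 0 < K) (ht : 2 * K ≤ t) :
    (1 / (2 * K) : ℝ) * t ≤ (t / K : ℕ) := by
  have hnat : t ≤ 2 * K * (t / K) := by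
    have h1 := Nat.div_add_mod t K
    have h2 := Nat.mod_lt t hK
    have hq : 2 ≤ t / K := (Nat.le_div_iff_mul_le hK).2 (by linarith)
    nlinarith
  have hreal : (t : ℝ) ≤ 2 * K * ((t / K : ℕ) : ℝ) := by exact_mod_cast hnat
  have hKpos : (0 : ℝ) < 2 * K := by positivity
  rw [one_div_mul_eq_div, div_le_iff₀ hKpos]
  linarith

/-- **FORM A of the support item `GridCorCliqueFace`, from abstract blocks.**  Under the hypotheses
of `face_image_eq_of_blocks` (a crossover block and a junction block of pitch `K ≥ 1` with the
three finite properties validity / descend / lift), for every `t ≥ 2K` there is a face of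
`COR(G_{t,t})`, cut out by finitely many inequalities each valid on all of `COR(G_{t,t})`, whose image
under a linear map is `COR(K_h)` with `h = ⌊t/K⌋ ≥ t/(2K)` — i.e. the statement
`∃ c > 0, ∃ t₀, ∀ t ≥ t₀, ∃ h ≥ c·t, ∃ k cv δ π, (∀ i, ∀ x ∈ COR(G_{t,t}), cv i ⬝ᵥ x ≤ δ i) ∧
π '' (COR(G_{t,t}) ∩ {x | ∀ i, cv i ⬝ᵥ x = δ i}) = COR(K_h)` with `c = 1/(2K)`, `t₀ = 2K`.
This is the core of the printed proof of Theorem 6 ("a face of `COR(H)` which projects to the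
correlation polytope of the complete [bipartite] graph", realized in place on `COR(G_{t,t})`; the
constants `c`, `t₀` are the construction's, print gives none).
[cite: AboulkerEtAl2019, Thm. 6 and its proof (arXiv:1806.00541 p0005 L41 – p0006 L27)] -/
theorem formA_of_blocks {K : ℕ} (hK : 0 < K) {nX nJ : ℕ}
    (rowsX : ∀ t : ℕ, ℕ → ℕ → Fin nX → (Fin (t * t) × Fin (t * t) → ℝ)) (rhsX : Fin nX → ℝ)
    (rowsJ : ∀ t : ℕ, ℕ → Fin nJ → (Fin (t * t) × Fin (t * t) → ℝ)) (rhsJ : Fin nJ → ℝ)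
    (ttX : Fin K × Fin K → Bool → Bool → Bool) (ttJ : Fin K × Fin K → Bool → Bool)
    (pl pr pt pb ra rb : Fin K × Fin K)
    (hplr : pl.1 = pr.1) (hpl : (pl.2 : ℕ) = 0) (hpr : (pr.2 : ℕ) = K - 1)
    (hptb : pt.2 = pb.2) (hpt : (pt.1 : ℕ) = 0) (hpb : (pb.1 : ℕ) = K - 1)
    (hrab : (ra.1 = rb.1 ∧ ((ra.2 : ℕ) + 1 = rb.2 ∨ (rb.2 : ℕ) + 1 = ra.2)) ∨
      (ra.2 = rb.2 ∧ ((ra.1 : ℕ) + 1 = rb.1 ∨ (rb.1 : ℕ) + 1 = ra.1)))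
    (httX : ∀ A B, ttX pl A B = A ∧ ttX pr A B = A ∧ ttX pt A B = B ∧ ttX pb A B = B)
    (httJ : ∀ A, ttJ pl A = A ∧ ttJ pr A = A ∧ ttJ pt A = A ∧ ttJ pb A = A)
    (hXvalid : ∀ t i j, K * i + K ≤ t → K * j + K ≤ t →
      ∀ r b, rowsX t i j r ⬝ᵥ corVec (gridGraph t) b ≤ rhsX r)
    (hXdesc : ∀ (t i j : ℕ) (ι : Fin K × Fin K → Fin (t * t)),
      (∀ p, (ι p : ℕ) = (K * i + p.1) * t + (K * j + p.2)) → K * i + K ≤ t → K * j + K ≤ t →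
      ∀ b : Fin (t * t) → Bool, (∀ r, rowsX t i j r ⬝ᵥ corVec (gridGraph t) b = rhsX r) →
        b (ι pr) = b (ι pl) ∧ b (ι pt) = b (ι pb) ∧ b (ι ra) = b (ι pl) ∧ b (ι rb) = b (ι pb))
    (hXlift : ∀ (t i j : ℕ) (ι : Fin K × Fin K → Fin (t * t)),
      (∀ p, (ι p : ℕ) = (K * i + p.1) * t + (K * j + p.2)) → K * i + K ≤ t → K * j + K ≤ t →
      ∀ (A B : Bool) (b : Fin (t * t) → Bool), (∀ p, b (ι p) = ttX p A B) →
        ∀ r, rowsX t i j r ⬝ᵥ corVec (gridGraph t) b = rhsX r)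
    (hJvalid : ∀ t i, K * i + K ≤ t → ∀ r b, rowsJ t i r ⬝ᵥ corVec (gridGraph t) b ≤ rhsJ r)
    (hJdesc : ∀ (t i : ℕ) (ι : Fin K × Fin K → Fin (t * t)),
      (∀ p, (ι p : ℕ) = (K * i + p.1) * t + (K * i + p.2)) → K * i + K ≤ t →
      ∀ b : Fin (t * t) → Bool, (∀ r, rowsJ t i r ⬝ᵥ corVec (gridGraph t) b = rhsJ r) →
        b (ι pr) = b (ι pl) ∧ b (ι pt) = b (ι pl) ∧ b (ι pb) = b (ι pl))
    (hJlift : ∀ (t i : ℕ) (ι : Fin K × Fin K → Fin (t * t)),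
      (∀ p, (ι p : ℕ) = (K * i + p.1) * t + (K * i + p.2)) → K * i + K ≤ t →
      ∀ (A : Bool) (b : Fin (t * t) → Bool), (∀ p, b (ι p) = ttJ p A) →
        ∀ r, rowsJ t i r ⬝ᵥ corVec (gridGraph t) b = rhsJ r) :
    ∃ c : ℝ, 0 < c ∧ ∃ t₀ : ℕ, ∀ t : ℕ, t₀ ≤ t → ∃ h : ℕ, c * t ≤ h ∧
      ∃ (k : ℕ) (cv : Fin k → (Fin (t * t) × Fin (t * t) → ℝ)) (δ : Fin k → ℝ)
        (π : (Fin (t * t) × Fin (t * t) → ℝ) →ₗ[ℝ] (Fin h × Fin h → ℝ)),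
        (∀ i, ∀ x ∈ corPolytopeGraph (gridGraph t), cv i ⬝ᵥ x ≤ δ i) ∧
          π '' (corPolytopeGraph (gridGraph t) ∩ {x | ∀ i, cv i ⬝ᵥ x = δ i}) =
            corPolytopeGraph (⊤ : SimpleGraph (Fin h)) := by
  refine ⟨1 / (2 * K), by positivity, 2 * K, fun t ht => ⟨t / K, pitch_bound hK ht, ?_⟩⟩
  exact face_image_eq_of_blocks hK rowsX rhsX rowsJ rhsJ ttX ttJ pl pr pt pb ra rb hplr hpl hpr
    hptb hpt hpb hrab httX httJ hXvalid hXdesc hXlift hJvalid hJdesc hJlift t (by omega)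

end GridCorTiling

end Literature.Combinatorics.Optimization

end
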